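import Mathlib
import Literature.NumberTheory.LFunctions.Zhang2022.TypedSection12CExact
import Literature.NumberTheory.LFunctions.Zhang2022.Section12Ded1217
import Literature.NumberTheory.LFunctions.Zhang2022.Section10cExpandSplit
import Literature.NumberTheory.LFunctions.Zhang2022.Section9FrontEndExact
import Literature.NumberTheory.LFunctions.Zhang2022.Section10CRanges1422
import HarnessLib

/-!
# Zhang (2022) §12 (12.13), exact reading: the top range `P″₁ < dr < P₂` of `S_j(𝐚₁₂,𝐚₂₅)` —
# front end (the exact `n = dr` form, the inner sums, the size of the exact window `𝓦ˣ_j`)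

Topic `Literature/NumberTheory/LFunctions/Zhang2022` (Landau–Siegel audit tree; verdict-neutral).
Y. Zhang, *Discrete mean estimates and the Landau–Siegel zero*, arXiv:2211.02515v1 (2022)
[Zhang2022LandauSiegel] — **an unrefereed manuscript under adjudication; theorem-only file (identities
and sizes), nothing here bears on its Theorems 1–2 or on Landau–Siegel zeros** (lane ZHANG-L, WP12,
seat zl-w12-p6; node `Typed.Sec12C.Top1225Ex` of `TypedSection12CExact`, RT-02).

First layer of the evaluation "By lemma 8.2, 8.3 and 12.3, the sum over `P″₁ < dr < P₂` [of
`S_j(𝐚₁₂,𝐚₂₅)`] is equal to …" (p. 71, tex L3614):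

* `SjOn_top_eq` — the substitution `n = dr` (EXACT): `S_j(𝐚₁₂,𝐚₂₅)|_{P″₁<dr<P₂} =
  Σ_{⌊P″₁⌋<n<⌈P₂⌉} Σ_{dr=n} w_j(d,r)·(ῑ₃M₃ + ῑ₄M₂)(d,r)·N(d,r)` with the §8/§9 weight
  `w_j(d,r) = |μ(r)||χ(dr)|λ₀ⱼ(dr)/(drφ(r))`, the §9 `m`-sums `M₃, M₂` of `ϰ₃, ϰ₂`
  (`Section9FrontEndExact.msum_eq`) and the `n`-sum `N(d,r) = Σ_n χ(n)ϰ̄₁₃(drn)ξ₀ⱼ(n;d,r)/n`;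
* `nsum25_eq`, `nsum25_eq_sum122` — `Σ_n 𝐚₂₅(drn)ξ₀ⱼ(n;d,r)/n = χ(dr)·N(d,r)` and `N = sum122` (Lemma
  12.2/12.3's sum, `Typed.Sec12B.sum122`; the truncations agree, `ϰ₁₃ = 0` from `P″₂ ≤ PT⁻²` on);
* `norm_frakwEx_le` — the exact window is bounded: `‖𝓦ˣ_j(y)‖ ≤ W₀(c′) = 1 + 3κ + 2κ²`,
  `κ = 3π(1 + 5|c′|π)`, for `1 ≤ y ≤ P` (`|(y/P″₁)^{β₆}| = 1`, `‖β‖ ≤ 3α(1+5|c′|π)`, `|log| ≤ 𝓛⁹`,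
  `α𝓛⁹ = π`, `|∫₁^X t^{β₆−1}(log t)dt| ≤ log²X`);
* `top_range_sizes` — `2T·P″₁ < P₃`, `P″₁ ≥ 1`, `P₂ ≤ PT⁻²`, … for `𝓛 ≥ 5`.

## References

* Y. Zhang, arXiv:2211.02515v1 (2022), §12 (12.13) p. 71, Lemma 12.3 proof p. 70 (u033); §9 p. 51;
  §8 p. 47; §7 Prop. 7.1. [cite: Zhang2022LandauSiegel, §12 (12.13) p. 71]
-/

noncomputable section

open Complex Real ComplexConjugate

namespace Literature.NumberTheory.LFunctions.Zhang2022.Typed.Sec12C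

open Literature.NumberTheory.LFunctions.Zhang2022.Skeleton
open Literature.NumberTheory.LFunctions.Zhang2022.Typed.Sec10C.Ranges1422
open Literature.NumberTheory.LFunctions.Zhang2022.Typed.Sec12B (sum122)

namespace Top1225

/-! ### Parameter sizes (`P″₁ = P^{0.496}Dt₀`, `P″₂ = P^{0.5}Dt₀`, `P₃ = P^{0.498}`, `P₂ = P^{0.5}T⁻¹⁰`) -/

section Params

variable {D : ℕ}

/-- `𝓛^{1.1} ≤ 𝓛²` and `𝓛 ≤ 𝓛^{1.1}` for `𝓛 ≥ 1` (`log T = 𝓛^{1.1}`, (2.6)); helper for the §12 top range.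
[cite: Zhang2022LandauSiegel, §2 (2.6) p. 5] -/
theorem ell_rpow_facts (h1 : 1 ≤ ell D) :
    ell D ^ (1.1 : ℝ) ≤ ell D ^ 2 ∧ ell D ≤ ell D ^ (1.1 : ℝ) := by
  constructor
  · have h : ell D ^ (1.1 : ℝ) ≤ ell D ^ (2 : ℝ) :=
      Real.rpow_le_rpow_of_exponent_le h1 (by norm_num)
    simpa using h
  · have h : ell D ^ (1 : ℝ) ≤ ell D ^ (1.1 : ℝ) :=
      Real.rpow_le_rpow_of_exponent_le h1 (by norm_num)
    simpa using h

/-- `12L² + 520L + 1 ≤ 0.002L⁹` for `L ≥ 5` (the polynomial comparison behind `T·P″₁ < P₃`, (2.21));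
helper for the §12 top range. [cite: Zhang2022LandauSiegel, §2 (2.21) p. 9] -/
theorem poly_aux {L : ℝ} (hL : 5 ≤ L) : 12 * L ^ 2 + 520 * L + 1 ≤ 0.002 * L ^ 9 := by
  have hL0 : 0 ≤ L := by linarith
  have h7 : (78125 : ℝ) ≤ L ^ 7 := le_trans (by norm_num) (pow_le_pow_left₀ (by norm_num) hL 7)
  have h9 : 78125 * L ^ 2 ≤ L ^ 9 := by
    rw [show L ^ 9 = L ^ 7 * L ^ 2 by ring]
    exact mul_le_mul_of_nonneg_right h7 (by positivity)
  nlinarith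

/-- `P″₁ = e^{0.496𝓛⁹}·(Dt₀)`. [cite: Zhang2022LandauSiegel, §12 p. 67] -/
theorem P1pp_eq_exp_mul (D : ℕ) : P1pp D = Real.exp (0.496 * ell D ^ 9) * ((D : ℝ) * t0 D) := by
  rw [P1pp, bigP, ← Real.exp_mul]; ring

/-- `P″₂ = e^{0.5𝓛⁹}·(Dt₀)`. [cite: Zhang2022LandauSiegel, §12 p. 67] -/
theorem P2pp_eq_exp_mul (D : ℕ) : P2pp D = Real.exp (0.5 * ell D ^ 9) * ((D : ℝ) * t0 D) := by
  rw [P2pp, bigP, ← Real.exp_mul]; ring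

/-- `Dt₀ ≤ e^{520𝓛}` for `𝓛 ≥ 3`. [cite: Zhang2022LandauSiegel, §2 (2.8)] -/
theorem Dt0_le_exp (hℓ : 3 ≤ ell D) : (D : ℝ) * t0 D ≤ Real.exp (520 * ell D) := by
  have h := Real.exp_le_exp.mpr (log_Dt0_le (D := D) hℓ)
  rwa [Real.exp_log (Dt0_pos hℓ)] at h

/-- `0 ≤ log P″₁ ≤ 0.496𝓛⁹ + 520𝓛`, `0 ≤ log P″₂ ≤ 0.5𝓛⁹ + 520𝓛` (`𝓛 ≥ 3`).
[cite: Zhang2022LandauSiegel, §12 p. 67] -/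
theorem log_P1pp_P2pp_bounds (hℓ : 3 ≤ ell D) :
    0 ≤ Real.log (P1pp D) ∧ Real.log (P1pp D) ≤ 0.496 * ell D ^ 9 + 520 * ell D ∧
      0 ≤ Real.log (P2pp D) ∧ Real.log (P2pp D) ≤ 0.5 * ell D ^ 9 + 520 * ell D := by
  have h0 : 0 < ell D := by linarith
  have hDt := Dt0_pos (D := D) hℓ
  have hl := log_Dt0_le (D := D) hℓ
  have hl0 := log_Dt0_nonneg (D := D) hℓ
  have e1 : Real.log (P1pp D) = 0.496 * ell D ^ 9 + Real.log ((D : ℝ) * t0 D) := by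
    rw [P1pp_eq_exp_mul, Real.log_mul (Real.exp_pos _).ne' hDt.ne', Real.log_exp]
  have e2 : Real.log (P2pp D) = 0.5 * ell D ^ 9 + Real.log ((D : ℝ) * t0 D) := by
    rw [P2pp_eq_exp_mul, Real.log_mul (Real.exp_pos _).ne' hDt.ne', Real.log_exp]
  refine ⟨?_, ?_, ?_, ?_⟩
  · rw [e1]; positivity
  · rw [e1]; linarith
  · rw [e2]; positivity
  · rw [e2]; linarith

/-- Sizes on the top range, for `𝓛 ≥ 5`: `2T·P″₁ < P₃`, `1 ≤ P″₁`, `P″₁ < P₃`, `P₃ ≤ P₂`,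
`P₂ ≤ PT⁻²`, `P₂ ≤ P`, `P″₂ ≤ P`. [cite: Zhang2022LandauSiegel, §2 (2.21), §12 p. 67] -/
theorem top_range_sizes (hℓ5 : 5 ≤ ell D) :
    2 * bigT D * P1pp D < Skeleton.P3 D ∧ 1 ≤ P1pp D ∧ P1pp D < Skeleton.P3 D ∧
      Skeleton.P3 D ≤ Skeleton.P2 D ∧ Skeleton.P2 D ≤ bigP D / bigT D ^ 2 ∧
      Skeleton.P2 D ≤ bigP D ∧ P2pp D ≤ bigP D := by
  have hℓ4 : 4 ≤ ell D := by linarith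
  have hℓ : 3 ≤ ell D := by linarith
  have h1 : 1 ≤ ell D := by linarith
  have h0 : 0 < ell D := by linarith
  obtain ⟨h11, h1r⟩ := ell_rpow_facts h1
  have hpoly := poly_aux hℓ5
  have hL2 : 0 ≤ ell D ^ 2 := by positivity
  have hDt1 := Dt0_ge_one (D := D) hℓ
  have hDt := Dt0_le_exp hℓ
  have hT : bigT D = Real.exp (ell D ^ (1.1 : ℝ)) := rfl
  have hT1 : 1 ≤ bigT D := by rw [hT]; exact Real.one_le_exp (by positivity)
  have hlog2 : Real.log 2 ≤ 1 := by have := Real.log_two_lt_d9; linarith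
  have h2 : (2 : ℝ) = Real.exp (Real.log 2) := (Real.exp_log (by norm_num)).symm
  obtain ⟨hP2N, hP32⟩ := Section9FrontEndExact.scales_ok (D := D) hℓ4
  refine ⟨?_, ?_, ?_, hP32, hP2N, (P2_lt_bigP hℓ).le, ?_⟩
  · have hTP : 2 * bigT D * P1pp D ≤
        Real.exp (Real.log 2 + ell D ^ (1.1 : ℝ) + 0.496 * ell D ^ 9 + 520 * ell D) := by
      rw [Real.exp_add, Real.exp_add, Real.exp_add, hT, P1pp_eq_exp_mul, ← h2, ← mul_assoc]
      exact mul_le_mul_of_nonneg_left hDt (by positivity)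
    refine hTP.trans_lt ?_
    rw [Skeleton.P3, bigP, ← Real.exp_mul, Real.exp_lt_exp]
    linarith
  · rw [P1pp_eq_exp_mul]
    exact one_le_mul_of_one_le_of_one_le (Real.one_le_exp (by positivity)) hDt1
  · have hle : P1pp D ≤ 2 * bigT D * P1pp D := by
      have : 0 ≤ P1pp D := Sec12D.P1pp_nonneg D
      nlinarith
    exact hle.trans_lt (by
      have hTP : 2 * bigT D * P1pp D ≤
          Real.exp (Real.log 2 + ell D ^ (1.1 : ℝ) + 0.496 * ell D ^ 9 + 520 * ell D) := by
        rw [Real.exp_add, Real.exp_add, Real.exp_add, hT, P1pp_eq_exp_mul, ← h2, ← mul_assoc]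
        exact mul_le_mul_of_nonneg_left hDt (by positivity)
      refine hTP.trans_lt ?_
      rw [Skeleton.P3, bigP, ← Real.exp_mul, Real.exp_lt_exp]
      linarith)
  · have hle : P2pp D ≤ Real.exp (0.5 * ell D ^ 9 + 520 * ell D) := by
      rw [Real.exp_add, P2pp_eq_exp_mul]
      exact mul_le_mul_of_nonneg_left hDt (by positivity)
    refine hle.trans ?_
    rw [bigP, Real.exp_le_exp]
    linarith

end Params

/-! ### The size of the exact window `𝓦ˣ_j` -/

section Window

variable (c' : ℝ) {D : ℕ}

/-- `‖∫₁^X f‖ ≤ K·|log X|` when `‖f(t)‖ ≤ K/t` between `1` and `X` (`X > 0`) — the size of the two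
integrals `∫₁^{P″₂/dr} y^{β₆−w−1}(log y)dy` of Lemma 12.3's proof (u031/u033); helper for the §12 top range.
[cite: Zhang2022LandauSiegel, §12 Lemma 12.3 proof p. 70, tex L3571–L3586] -/
theorem norm_integral_le_mul_abs_log {X K : ℝ} (hX : 0 < X) {f : ℝ → ℂ}
    (hf : ∀ t : ℝ, min 1 X ≤ t → t ≤ max 1 X → ‖f t‖ ≤ K / t) :
    ‖∫ t in (1:ℝ)..X, f t‖ ≤ K * |Real.log X| := by
  have hint : ∀ {a b : ℝ}, 0 < a → a ≤ b →
      IntervalIntegrable (fun t : ℝ => K / t) MeasureTheory.volume a b := by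
    intro a b ha hab
    have h : IntervalIntegrable (fun t : ℝ => t⁻¹) MeasureTheory.volume a b :=
      intervalIntegral.intervalIntegrable_inv (fun x hx => by
        rw [Set.uIcc_of_le hab] at hx; exact (lt_of_lt_of_le ha hx.1).ne') continuousOn_id
    have := h.const_mul K
    refine this.congr ?_
    · exact fun t => by simp [div_eq_mul_inv]
  have hval : ∀ {a b : ℝ}, 0 < a → 0 < b → ∫ t in a..b, K / t = K * Real.log (b / a) := by
    intro a b ha hb
    have h0 : (0 : ℝ) ∉ Set.uIcc a b := by
      intro h
      rcases le_total a b with hab | hab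
      · rw [Set.uIcc_of_le hab] at h; linarith [h.1]
      · rw [Set.uIcc_of_ge hab] at h; linarith [h.1]
    have e : (∫ t in a..b, K / t) = ∫ t in a..b, K * t⁻¹ := by simp_rw [div_eq_mul_inv]
    rw [e, intervalIntegral.integral_const_mul, integral_inv h0]
  rcases le_or_gt 1 X with h1X | hX1
  · have hmin : min 1 X = 1 := min_eq_left h1X
    have hmax : max 1 X = X := max_eq_right h1X
    have hb := intervalIntegral.norm_integral_le_of_norm_le h1X (f := f) (g := fun t => K / t)
      (μ := MeasureTheory.volume)
      (Filter.Eventually.of_forall fun t ht =>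
        hf t (by rw [hmin]; exact ht.1.le) (by rw [hmax]; exact ht.2))
      (hint one_pos h1X)
    rw [hval one_pos hX, div_one, abs_of_nonneg (Real.log_nonneg h1X)] at *
    exact hb
  · have hmin : min 1 X = X := min_eq_right hX1.le
    have hmax : max 1 X = 1 := max_eq_left hX1.le
    rw [intervalIntegral.integral_symm, norm_neg]
    have hb := intervalIntegral.norm_integral_le_of_norm_le hX1.le (f := f) (g := fun t => K / t)
      (μ := MeasureTheory.volume)
      (Filter.Eventually.of_forall fun t ht =>
        hf t (by rw [hmin]; exact ht.1.le) (by rw [hmax]; exact ht.2))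
      (hint hX hX1.le)
    rw [hval hX one_pos, one_div, Real.log_inv] at hb
    rw [abs_of_neg (Real.log_neg hX hX1)]
    exact hb

/-- For `X > 0` and `Re b = 0`: `‖∫₁^X t^{b−1}dt‖ ≤ |log X|` and `‖∫₁^X t^{b−1}log t dt‖ ≤ |log X|²` (the two
integrals of u031/u033, p. 70). [cite: Zhang2022LandauSiegel, §12 Lemma 12.3 proof p. 70, tex L3571–L3586] -/
theorem norm_model_integrals_le {X : ℝ} (hX : 0 < X) {b : ℂ} (hb : b.re = 0) :
    ‖∫ t in (1:ℝ)..X, (t : ℂ) ^ (b - 1)‖ ≤ |Real.log X| ∧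
      ‖∫ t in (1:ℝ)..X, (t : ℂ) ^ (b - 1) * (Real.log t : ℂ)‖ ≤ |Real.log X| ^ 2 := by
  have hmin0 : 0 < min 1 X := lt_min one_pos hX
  have hnorm : ∀ t : ℝ, 0 < t → ‖(t : ℂ) ^ (b - 1)‖ = 1 / t := by
    intro t ht
    rw [Complex.norm_cpow_eq_rpow_re_of_pos ht, Complex.sub_re, hb, Complex.one_re, zero_sub,
      Real.rpow_neg_one, one_div]
  have hlogle : ∀ t : ℝ, min 1 X ≤ t → t ≤ max 1 X → |Real.log t| ≤ |Real.log X| := by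
    intro t ht1 ht2
    have ht : 0 < t := lt_of_lt_of_le hmin0 ht1
    rcases le_or_gt 1 X with h1X | hX1
    · rw [min_eq_left h1X] at ht1; rw [max_eq_right h1X] at ht2
      rw [abs_of_nonneg (Real.log_nonneg ht1), abs_of_nonneg (Real.log_nonneg h1X)]
      exact Real.log_le_log ht ht2
    · rw [min_eq_right hX1.le] at ht1; rw [max_eq_left hX1.le] at ht2
      rw [abs_of_nonpos (Real.log_nonpos ht.le ht2), abs_of_neg (Real.log_neg hX hX1), neg_le_neg_iff]
      exact Real.log_le_log hX ht1
  constructor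
  · have h := norm_integral_le_mul_abs_log hX (K := 1) (f := fun t : ℝ => (t : ℂ) ^ (b - 1))
      (fun t ht1 _ => by
        rw [hnorm t (lt_of_lt_of_le hmin0 ht1)])
    rwa [one_mul] at h
  · have h := norm_integral_le_mul_abs_log hX (K := |Real.log X|)
      (f := fun t : ℝ => (t : ℂ) ^ (b - 1) * (Real.log t : ℂ)) (fun t ht1 ht2 => by
      have ht : 0 < t := lt_of_lt_of_le hmin0 ht1
      rw [norm_mul, hnorm t ht, Complex.norm_real, Real.norm_eq_abs, one_div, ← div_eq_inv_mul]
      exact div_le_div_of_nonneg_right (hlogle t ht1 ht2) ht.le)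
    rwa [← pow_two] at h

/-- **The exact window is bounded on `[1, P]`**: `‖𝓦ˣ_j(y)‖ ≤ 1 + 3κ + 2κ²`, `κ = 3π(1+5|c′|π)`
(`𝓛 ≥ 3`; `|(y/P″₁)^{β₆}| = 1`, every `β` has norm `≤ 3α(1+5|c′|π)`, the two logarithms
`log(y/P″₁)`, `log(P″₂/y)` have modulus `≤ 𝓛⁹`, and `α𝓛⁹ = π`).
[cite: Zhang2022LandauSiegel, §12 Lemma 12.3 proof p. 70, tex L3581] -/
theorem norm_frakwEx_le (hℓ : 3 ≤ ell D) (j : ℕ) {y : ℝ} (hy1 : 1 ≤ y) (hyP : y ≤ bigP D) :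
    ‖frakwEx c' D j y‖ ≤
      1 + 3 * (3 * π * (1 + 5 * |c'| * π)) + 2 * (3 * π * (1 + 5 * |c'| * π)) ^ 2 := by
  have h1 : 1 ≤ ell D := by linarith
  have h0 : 0 < ell D := by linarith
  have hlog1 : 1 ≤ Real.log D := h1
  have hy0 : 0 < y := by linarith
  have hP1 := Sec12D.P1pp_pos hlog1
  have hP2 := Sec12D.P2pp_pos hlog1
  obtain ⟨hlP1lo, hlP1hi, hlP2lo, hlP2hi⟩ := log_P1pp_P2pp_bounds hℓ
  have hpoly : 520 * ell D ≤ 0.5 * ell D ^ 9 := by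
    have h8 : (3 : ℝ) ^ 8 ≤ ell D ^ 8 := pow_le_pow_left₀ (by norm_num) hℓ 8
    nlinarith
  have hlogy : 0 ≤ Real.log y ∧ Real.log y ≤ ell D ^ 9 := log_le_of_le_bigP hy1 hyP
  -- the two logarithms
  set Λ : ℝ := ell D ^ 9 with hΛ
  have hL1 : |Real.log (y / P1pp D)| ≤ Λ := by
    rw [Real.log_div hy0.ne' hP1.ne', abs_le]; constructor <;> linarith [hlogy.1, hlogy.2]
  set X : ℝ := P2pp D / y with hX
  have hX0 : 0 < X := div_pos hP2 hy0
  have hL2 : |Real.log X| ≤ Λ := by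
    rw [hX, Real.log_div hP2.ne' hy0.ne', abs_le]; constructor <;> linarith [hlogy.1, hlogy.2]
  -- the β's
  set b : ℝ := 3 * alpha D * (1 + 5 * |c'| * π) with hb
  have hα := Sec12D.alpha_pos_of_log hlog1 (D := D)
  have hb0 : 0 ≤ b := by rw [hb]; positivity
  have hβ1 : ‖betaJ c' D (j + 1)‖ ≤ b := Sec12D.norm_betaJ_le c' hlog1 _
  have hβ2 : ‖betaJ c' D (j + 2)‖ ≤ b := Sec12D.norm_betaJ_le c' hlog1 _
  have hβ6 : ‖beta6 D‖ ≤ b := by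
    rw [(Sec12D.norm_beta67 hlog1 (D := D)).1, hb]
    have : 0 ≤ alpha D * (5 * |c'| * π) := by positivity
    nlinarith
  have hβ6re : (beta6 D).re = 0 := by simp [beta6]
  -- `b·Λ = κ`
  set κ : ℝ := 3 * π * (1 + 5 * |c'| * π) with hκ
  have hbΛ : b * Λ = κ := by
    rw [hb, hΛ, hκ]
    have := (alpha_facts (D := D) hℓ).2.2
    calc 3 * alpha D * (1 + 5 * |c'| * π) * ell D ^ 9
        = 3 * (alpha D * ell D ^ 9) * (1 + 5 * |c'| * π) := by ring
      _ = 3 * π * (1 + 5 * |c'| * π) := by rw [this]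
  have hκ0 : 0 ≤ κ := by rw [hκ]; positivity
  -- the pieces
  have hU : ‖(((y / P1pp D : ℝ)) : ℂ) ^ beta6 D‖ = 1 := by
    rw [Complex.norm_cpow_eq_rpow_re_of_pos (div_pos hy0 hP1), hβ6re, Real.rpow_zero]
  obtain ⟨hI1, hI2⟩ := norm_model_integrals_le hX0 hβ6re
  have hI1' : ‖∫ t in (1:ℝ)..X, (t : ℂ) ^ (beta6 D - 1)‖ ≤ Λ := hI1.trans hL2
  have hI2' : ‖∫ t in (1:ℝ)..X, (t : ℂ) ^ (beta6 D - 1) * (Real.log t : ℂ)‖ ≤ Λ ^ 2 :=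
    hI2.trans (pow_le_pow_left₀ (abs_nonneg _) hL2 2)
  have hlogC : ‖(Real.log (y / P1pp D) : ℂ)‖ ≤ Λ := by
    rw [Complex.norm_real, Real.norm_eq_abs]; exact hL1
  have hββ : ‖betaJ c' D (j + 1) * betaJ c' D (j + 2)‖ ≤ b * b := by
    rw [norm_mul]; exact mul_le_mul hβ1 hβ2 (norm_nonneg _) hb0
  -- first bracket
  have hA : ‖(1 : ℂ) - betaJ c' D (j + 1) * betaJ c' D (j + 2) *
      ∫ t in (1:ℝ)..X, (t : ℂ) ^ (beta6 D - 1) * (Real.log t : ℂ)‖ ≤ 1 + κ ^ 2 := by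
    refine (norm_sub_le _ _).trans ?_
    rw [norm_one, norm_mul]
    have : ‖betaJ c' D (j + 1) * betaJ c' D (j + 2)‖ *
        ‖∫ t in (1:ℝ)..X, (t : ℂ) ^ (beta6 D - 1) * (Real.log t : ℂ)‖ ≤ (b * b) * Λ ^ 2 :=
      mul_le_mul hββ hI2' (norm_nonneg _) (by positivity)
    have e : (b * b) * Λ ^ 2 = κ ^ 2 := by rw [← hbΛ]; ring
    linarith
  -- second bracket
  have hB : ‖-beta6 D + betaJ c' D (j + 1) + betaJ c' D (j + 2) +
      betaJ c' D (j + 1) * betaJ c' D (j + 2) * ∫ t in (1:ℝ)..X, (t : ℂ) ^ (beta6 D - 1)‖ ≤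
      3 * b + b * b * Λ := by
    have h3 : ‖-beta6 D + betaJ c' D (j + 1) + betaJ c' D (j + 2)‖ ≤ 3 * b := by
      refine (norm_add₃_le).trans ?_
      rw [norm_neg]; linarith
    have h4 : ‖betaJ c' D (j + 1) * betaJ c' D (j + 2) * ∫ t in (1:ℝ)..X, (t : ℂ) ^ (beta6 D - 1)‖ ≤
        b * b * Λ := by
      rw [norm_mul]; exact mul_le_mul hββ hI1' (norm_nonneg _) (by positivity)
    exact (norm_add_le _ _).trans (add_le_add h3 h4)
  -- assemble
  have e : frakwEx c' D j y =
      -((((y / P1pp D : ℝ)) : ℂ) ^ beta6 D *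
          (1 - betaJ c' D (j + 1) * betaJ c' D (j + 2) *
            ∫ t in (1:ℝ)..X, (t : ℂ) ^ (beta6 D - 1) * (Real.log t : ℂ)) -
        (((y / P1pp D : ℝ)) : ℂ) ^ beta6 D * (Real.log (y / P1pp D) : ℂ) *
          (-beta6 D + betaJ c' D (j + 1) + betaJ c' D (j + 2) +
            betaJ c' D (j + 1) * betaJ c' D (j + 2) *
              ∫ t in (1:ℝ)..X, (t : ℂ) ^ (beta6 D - 1))) := rfl
  rw [e, norm_neg]
  refine (norm_sub_le _ _).trans ?_
  rw [norm_mul, norm_mul, norm_mul, hU, one_mul, one_mul]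
  calc ‖(1 : ℂ) - betaJ c' D (j + 1) * betaJ c' D (j + 2) *
          ∫ t in (1:ℝ)..X, (t : ℂ) ^ (beta6 D - 1) * (Real.log t : ℂ)‖ +
        ‖(Real.log (y / P1pp D) : ℂ)‖ *
          ‖-beta6 D + betaJ c' D (j + 1) + betaJ c' D (j + 2) +
            betaJ c' D (j + 1) * betaJ c' D (j + 2) * ∫ t in (1:ℝ)..X, (t : ℂ) ^ (beta6 D - 1)‖
      ≤ (1 + κ ^ 2) + Λ * (3 * b + b * b * Λ) :=
        add_le_add hA (mul_le_mul hlogC hB (norm_nonneg _) (by positivity))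
    _ = 1 + 3 * κ + 2 * κ ^ 2 := by rw [← hbΛ]; ring

end Window

/-! ### The inner sums of `S_j(𝐚₁₂,𝐚₂₅)` and the `n = dr` form of the top range -/

section FrontEnd

variable (c' : ℝ) {D : ℕ} [NeZero D] (χ : DirichletCharacter ℂ D)

omit [NeZero D] in
/-- **The `n`-sum of `S_j(𝐚₁₂,𝐚₂₅)` at `(d,r)`**: for `𝐚₂₅ = conj(χϰ₁₃)` and real `χ`,
`Σ_n 𝐚₂₅(drn)ξ₀ⱼ(n;d,r)/n = χ(dr)·Σ_n χ(n)ϰ̄₁₃(drn)ξ₀ⱼ(n;d,r)/n`.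
[cite: Zhang2022LandauSiegel, §12 (12.12) p. 71, tex L3600] -/
theorem nsum25_eq (hq : χ.IsQuadratic) {a25 : ℕ → ℂ}
    (ha25 : ∀ n, a25 n = conj (χ (n : ZMod D) * vk13 D n)) (j d r : ℕ) :
    ∑ n ∈ Finset.Ico 1 (Nsupp D), a25 (d * r * n) * xiZero c' D j n d r / (n : ℂ) =
      χ ((d * r : ℕ) : ZMod D) * ∑ n ∈ Finset.Ico 1 (Nsupp D),
        χ (n : ZMod D) * conj (vk13 D (d * r * n)) * xiZero c' D j n d r / (n : ℂ) := by
  rw [Finset.mul_sum]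
  refine Finset.sum_congr rfl fun n _ => ?_
  rw [ha25]
  simp only [Nat.cast_mul, map_mul, Sec10C.conj_eq_self_of_isQuadratic χ hq]
  ring

omit [NeZero D] in
/-- **The `n`-sum IS Lemma 12.2/12.3's sum** `Typed.Sec12B.sum122` (the truncations `⌈PT⁻²⌉` and
`⌈P″₂⌉` agree: `ϰ₁₃(drl) = 0` for `l ≥ P″₂`, and `P″₂ ≤ PT⁻²` for `𝓛 ≥ 3`).
[cite: Zhang2022LandauSiegel, §12 (12.10) p. 69, tex L3503] -/
theorem nsum25_eq_sum122 (hD : 3 ≤ Real.log D) (j : ℕ) {d r : ℕ} (hd : 1 ≤ d) (hr : 1 ≤ r) :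
    ∑ n ∈ Finset.Ico 1 (Nsupp D),
        χ (n : ZMod D) * conj (vk13 D (d * r * n)) * xiZero c' D j n d r / (n : ℂ) =
      sum122 c' χ j d r := by
  rw [sum122]
  have hsub : Finset.Ico 1 ⌈P2pp D⌉₊ ⊆ Finset.Ico 1 (Nsupp D) :=
    Finset.Ico_subset_Ico_right (Sec12D.ceil_P2pp_le_Nsupp hD)
  symm
  refine Finset.sum_subset hsub fun l hl hl' => ?_
  rw [Finset.mem_Ico] at hl
  have hlP : ⌈P2pp D⌉₊ ≤ l := by
    by_contra h
    exact hl' (Finset.mem_Ico.mpr ⟨hl.1, not_le.mp h⟩)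
  have hle : P2pp D ≤ ((d * r * l : ℕ) : ℝ) := by
    have h1 : P2pp D ≤ l := (Nat.le_ceil _).trans (by exact_mod_cast hlP)
    refine h1.trans ?_
    exact_mod_cast Nat.le_mul_of_pos_left l (Nat.mul_pos hd hr)
  rw [Sec12D.vk13_eq_zero_of_le hle, map_zero, mul_zero, zero_mul, zero_div]

omit [NeZero D] in
open scoped Classical in
/-- The top range as a set of `n = dr`: `{1 ≤ n < ⌈PT⁻²⌉ : P″₁ < n < P₂} = [⌊P″₁⌋ + 1, ⌈P₂⌉)`
when `P₂ ≤ PT⁻²`. [cite: Zhang2022LandauSiegel, §12 (12.13) p. 71] -/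
theorem filter_rngTop_eq (hP2N : Skeleton.P2 D ≤ bigP D / bigT D ^ 2) :
    (Finset.Ico 1 (Nsupp D)).filter (fun n => rngTop D n) =
      Finset.Ico (⌊P1pp D⌋₊ + 1) ⌈Skeleton.P2 D⌉₊ := by
  have hK : ⌈Skeleton.P2 D⌉₊ ≤ Nsupp D := by rw [Nsupp]; exact Nat.ceil_mono hP2N
  have hP1 : 0 ≤ P1pp D := Sec12D.P1pp_nonneg D
  ext n
  simp only [Finset.mem_filter, Finset.mem_Ico, rngTop]
  constructor
  · rintro ⟨⟨-, -⟩, h1, h2⟩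
    exact ⟨Nat.succ_le_of_lt ((Nat.floor_lt hP1).mpr h1), Nat.lt_ceil.mpr h2⟩
  · rintro ⟨h1, h2⟩
    have h1' : P1pp D < n := (Nat.floor_lt hP1).mp (Nat.lt_of_succ_le h1)
    exact ⟨⟨by omega, lt_of_lt_of_le h2 hK⟩, h1', Nat.lt_ceil.mp h2⟩

open scoped Classical in
/-- **The top range of `S_j(𝐚₁₂,𝐚₂₅)` in the `n = dr` form** (EXACT identity; `P₂ ≤ PT⁻²`, `χ` real,
`𝐚₂₅ = conj(χϰ₁₃)`): `S_j(𝐚₁₂,𝐚₂₅)|_{P″₁<dr<P₂} = Σ_{⌊P″₁⌋<n<⌈P₂⌉}Σ_{dr=n} w_j(d,r)·(ῑ₃M₃+ῑ₄M₂)(d,r)·N(d,r)`,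
`w_j(d,r) = |μ(r)||χ(dr)|λ₀ⱼ(dr)/(drφ(r))`, `M_k(d,r) = Σ_m χ(m)ϰ_k(drm)m^{β_j−1}`,
`N(d,r) = Σ_n χ(n)ϰ̄₁₃(drn)ξ₀ⱼ(n;d,r)/n` (`Section9FrontEndExact.msum_eq`, `nsum25_eq`, `χ(dr)² = |χ(dr)|`).
[cite: Zhang2022LandauSiegel, §12 (12.13) p. 71, tex L3600–L3614] -/
theorem SjOn_top_eq (hq : χ.IsQuadratic) (hP2N : Skeleton.P2 D ≤ bigP D / bigT D ^ 2) (j : ℕ)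
    {a25 : ℕ → ℂ} (ha25 : ∀ n, a25 n = conj (χ (n : ZMod D) * vk13 D n)) :
    SjOn c' D j (a12 χ) a25 (rngTop D) =
      ∑ n ∈ Finset.Ico (⌊P1pp D⌋₊ + 1) ⌈Skeleton.P2 D⌉₊, ∑ p ∈ Nat.divisorsAntidiagonal n,
        ((ArithmeticFunction.moebius p.2).natAbs : ℂ) * (‖χ ((p.1 * p.2 : ℕ) : ZMod D)‖ : ℂ) /
              (((p.1 * p.2 : ℕ) : ℂ) * (Nat.totient p.2 : ℂ)) * lamZero c' D j (p.1 * p.2) *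
          ((conj iota3 * (∑ m ∈ Finset.Ico 1 (Nsupp D),
                χ (m : ZMod D) * vk3 D (p.1 * p.2 * m) / (m : ℂ) ^ (1 - betaJ c' D j)) +
              conj iota4 * ∑ m ∈ Finset.Ico 1 (Nsupp D),
                χ (m : ZMod D) * vk2 D (p.1 * p.2 * m) / (m : ℂ) ^ (1 - betaJ c' D j)) *
            ∑ n' ∈ Finset.Ico 1 (Nsupp D),
              χ (n' : ZMod D) * conj (vk13 D (p.1 * p.2 * n')) * xiZero c' D j n' p.1 p.2 /
                (n' : ℂ)) := by
  have hpN : ∀ n, rngTop D n → n < Nsupp D := by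
    intro n hn
    have h : (n : ℝ) < Nsupp D := by
      calc (n : ℝ) < Skeleton.P2 D := hn.2
        _ ≤ bigP D / bigT D ^ 2 := hP2N
        _ ≤ ⌈bigP D / bigT D ^ 2⌉₊ := Nat.le_ceil _
        _ = (Nsupp D : ℝ) := by rw [Nsupp]
    exact_mod_cast h
  unfold SjOn
  rw [sum_box_ite_eq_sum_divisors (Nsupp D) (rngTop D) hpN, filter_rngTop_eq hP2N]
  refine Finset.sum_congr rfl fun n _ => ?_
  rw [Nat.sum_divisorsAntidiagonal' (fun d r =>
    ((ArithmeticFunction.moebius r).natAbs : ℂ) * (‖χ ((d * r : ℕ) : ZMod D)‖ : ℂ) /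
          (((d * r : ℕ) : ℂ) * (Nat.totient r : ℂ)) * lamZero c' D j (d * r) *
      ((conj iota3 * (∑ m ∈ Finset.Ico 1 (Nsupp D),
            χ (m : ZMod D) * vk3 D (d * r * m) / (m : ℂ) ^ (1 - betaJ c' D j)) +
          conj iota4 * ∑ m ∈ Finset.Ico 1 (Nsupp D),
            χ (m : ZMod D) * vk2 D (d * r * m) / (m : ℂ) ^ (1 - betaJ c' D j)) *
        ∑ n' ∈ Finset.Ico 1 (Nsupp D),
          χ (n' : ZMod D) * conj (vk13 D (d * r * n')) * xiZero c' D j n' d r / (n' : ℂ)))]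
  refine Finset.sum_congr rfl fun r _ => ?_
  rw [Section9FrontEndExact.msum_eq χ c' j (n / r * r), nsum25_eq c' χ hq ha25 j (n / r) r,
    ← Sec10C.sq_eq_norm_of_isQuadratic χ hq ((n / r * r : ℕ) : ZMod D)]
  ring

end FrontEnd

end Top1225

end Literature.NumberTheory.LFunctions.Zhang2022.Typed.Sec12C
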